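import Mathlib
import HarnessLib
import Summits.HubbardSuperconductivity.HubbardSuperconductivity.Theorems.KLProgrammeKLRegimeTwoVolumeGluedSourcePair

/-!
# Route `KLProgramme` — crux K3, VL child `KLRegimeVolumeLimitV17F2` (stmt-HubbardSuperconductivity-20440), skeleton «cauchy» v9 (831d58cbda4d66f6):
# THE REGISTERED STUB `stub_vl_nestedFramed` FROM THE (vi) CHAIN'S NATIVE CURRENCY — the GLUED pinned defect at a DEEP fine pin
# (cell gate-hubbard-kl, seat hubbard-kl-k3c5-p3 g12, technique «OS-positivity-free direct assembly»)

k3c4-p1's own-top-frame two-volume induction (blueprint v4, evidence #36; scale-`0` base `…TwoVolumeScaleZeroTopFrame`, M4a) delivers, scale by scale and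
at the end for `A_V := srcTrunc 3 (klSrcAction V M β U μ K_V n⋆)` (`V = L, L″ = b·L`, own top flow frames `K_V`), the GLUED pinned defect at an `R`-deep fine
pin in the e-free form `Σ_{X : X 0 = pin} ‖kernel A_{L″} X − (if ∀ i j, ((X i).site j).val / L = ((X 0).site j).val / L then kernel A_L (residue string) else 0)‖`.
By `…TwoVolumeGluedSourcePair.twoEps_near_le_glued_add_far` this dominates the NEAR same-offset defect of door (h) up to far rows paid by token #24's weight
in both volumes, so:

* `tendsto_farRate_of_depth` (`2B/(1 + Λ·R L) → 0` for `R L → ∞`);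
* **`framedNestedFlowTextV17F2_of_srcActionGluedDefect_srcPinnedSums`** (door (j), ∘ door (h)): the v8-F2 text from «`∃ L₀ δ→0 B`, `∃ R → ∞`: for `L ≥ L₀`,
  `L″ = b·L`, eventually in `M`, an `(R L)`-deep fine pin `o_f` with `2ε·GLUED(o_f) ≤ δ L` and both volumes' degree-2 two-source pinned sums at `o_f`,
  `o_c := (t, red o⃗_f)` bounded by `B`»;
* **`stub_vl_nestedFramed_of_gluedDefect : (GLUED text) → <the REGISTERED type of v9's stub_vl_nestedFramed, byte for byte>`** — token #24 for BOTH volumes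
  is read from the stub's own hypothesis at `(P, R₁ = ⟨1,1,1⟩)`, `j = n⋆`, `s = m = 2` (`klSrcPinnedSum_two_two_le_of_sourceProfilesAt`); GLUED text = inside
  the VL binders under the tower: `∃ L₀, ∃ δ → 0, ∃ R : ℕ → ℕ → ∞, ∀ L ≥ L₀, ∀ L″ = b·L, ∃ M₀ ∀ M ≥ M₀, ∃ o_f (R L)-deep, 2ε·GLUED(o_f) ≤ δ L` — M4a's
  conclusion shape at degree `2`, pin = the `(+)` source leg `((o_f, (s₀, ↑, +)), copy 1)`.
So the (vi) spine may end in its OWN words and close `stub_vl_nestedFramed` BY NAME as `stub_vl_nestedFramed_of_gluedDefect ⟨spine⟩`.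
Proofs only; no definition; nothing asserts superconductivity.  References: BGM 2006 §2.4 (2.38), §2.9 (4.3)–(4.6); Salmhofer 1999 (2.102)–(2.106).
-/

noncomputable section

/-! ## §4 The doors: the registered stub text from the GLUED pinned defect at a deep fine pin -/

namespace Summit.HubbardSuperconductivity.HubbardSuperconductivity.Theorems.TwoPointAssembly

set_option linter.dupNamespace false -- summit = problem name (single-conjunct summit), D-0017

open Finset Filter Topology Complex Literature.MathematicalPhysics.QuantumLattice Literature.Probability.LatticeModels GrassmannAlgebra
open Summit.HubbardSuperconductivity.HubbardSuperconductivity.Theorems.KLRegimeSplit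
open Summit.HubbardSuperconductivity.HubbardSuperconductivity.Theorems.KLProgrammeLegKernels
open Summit.HubbardSuperconductivity.HubbardSuperconductivity.Theorems.EngineV8
open Summit.HubbardSuperconductivity.HubbardSuperconductivity.Theorems.TwoVolumeDefect
open Summit.HubbardSuperconductivity.HubbardSuperconductivity.Theorems.TwoVolumeSource

/-- The far-rows rate at a growing depth vanishes: `2(B+B′)/(1 + Λ·R L) → 0` when `R L → ∞` (`Λ > 0`). [folklore] -/
theorem tendsto_farRate_of_depth {Λ : ℝ} (hΛ : 0 < Λ) (B : ℝ) {Rd : ℕ → ℕ} (hRd : Tendsto Rd atTop atTop) :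
    Tendsto (fun L : ℕ => 2 * B / (1 + Λ * (Rd L : ℝ))) atTop (𝓝 0) := by
  refine Tendsto.div_atTop tendsto_const_nhds ?_
  have h1 : Tendsto (fun L : ℕ => Λ * (Rd L : ℝ)) atTop atTop := (tendsto_natCast_atTop_atTop.comp hRd).const_mul_atTop hΛ
  exact tendsto_atTop_add_const_left _ _ h1

/-- **Deep pins exist**: for `L″ = b·L` and `2R < L`, the fine site with all coordinates `R` is `R`-deep (residues `R ∈ [R, L − R)`). [folklore] -/
theorem exists_deepSite {b L Lf : ℕ} [NeZero Lf] (hLf : Lf = b * L) {R : ℕ} (hR : 2 * R < L) :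
    ∃ x' : TorusSite 2 Lf, ∀ j, R ≤ (x' j).val % L ∧ (x' j).val % L + R < L := by
  have hb : 1 ≤ b := by
    rcases Nat.eq_zero_or_pos b with h | h
    · exact absurd (by rw [hLf, h, zero_mul]) (NeZero.ne Lf)
    · exact h
  have hRLf : R < Lf := by
    calc R < L := by omega
      _ = 1 * L := (one_mul L).symm
      _ ≤ b * L := Nat.mul_le_mul_right L hb
      _ = Lf := hLf.symm
  refine ⟨fun _ => ((R : ℕ) : ZMod Lf), fun j => ?_⟩
  have hval : (((R : ℕ) : ZMod Lf)).val = R := by rw [ZMod.val_natCast, Nat.mod_eq_of_lt hRLf]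
  have hmod : R % L = R := Nat.mod_eq_of_lt (by omega)
  simp only [hval, hmod]
  omega

/-- **DOOR (j) — THE CHAIN'S OWN CURRENCY + TOKEN #24 FOR BOTH VOLUMES.**  The registered text of `stub_vl_nestedFramed` from: `∃ L₀ δ→0 B`, `∃ R → ∞`, for
`L ≥ L₀`, `L″ = b·L`, eventually in `M`, an `(R L)`-deep fine pin `o_f` with `2ε·GLUED(o_f) ≤ δ L` (the e-free glued pinned defect of the source-pair
kernels of `srcTrunc 3 (klSrcAction_V[K_V] n⋆)`, own flow frames, pin = the `(+)` source leg) and the two volumes' degree-2 two-source pinned sums at the pins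
`o_f`, `o_c := (t, red o⃗_f)` bounded by `B` (token #24 at `n⋆`, `s = m = 2`). [cite: BenfattoGiulianiMastropietro2006, §2.9 (4.3)-(4.6)] -/
theorem framedNestedFlowTextV17F2_of_srcActionGluedDefect_srcPinnedSums
    (hD : ∀ (G : GeoConsts) (P : SplitConsts) (Q : EngConsts) (R : RenConsts), G.WF → P.WF → Q.WF → R.WF →
      ∃ c₅ : ℝ, 0 < c₅ ∧ ∀ c : ℝ, 0 < c → c ≤ c₅ → ∃ U₀ : ℝ, 0 < U₀ ∧
        ∀ μ ∈ klWindowC, ∀ U : ℝ, 0 < U → U ≤ U₀ → ∀ β : ℝ, klBetaMin ≤ β → β ≤ Real.exp (c / U ^ 2) →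
          ∀ K : TrigPolyC4v, klPredsV17F2.frameOK R U (nScales β) μ K →
            ∀ (Lstar : ℕ) (Mstar : ℕ → ℕ), TowerP klPredsV17F2 G P Q R β U μ K Lstar Mstar →
              ∃ L₀ : ℕ, ∃ δ : ℕ → ℝ, ∃ B : ℝ, Tendsto δ atTop (𝓝 0) ∧ ∃ Rd : ℕ → ℕ, Tendsto Rd atTop atTop ∧
                ∀ (L : ℕ) [NeZero L], L₀ ≤ L → ∀ (L'' : ℕ) [NeZero L''] (b : ℕ), L'' = b * L → ∃ M₀ : ℕ, ∀ (M : ℕ) [NeZero M], M₀ ≤ M →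
                  ∃ of : SpaceTimeIdx L'' M, (∀ j, Rd L ≤ (of.2 j).val % L ∧ (of.2 j).val % L + Rd L < L) ∧
                    2 * imagTimeWeight β M *
                      (∑ X ∈ univ.filter (fun X : Fin 2 → SrcLabel L'' M (nScales β + 1) => X 0 = ((of, ((⟨0, sectorCount_pos _⟩, 0), 0)), 1)),
                        ‖kernel ℂ (srcTrunc ℂ (fun Y : SrcLabel L'' M (nScales β + 1) => Y.2 = 1) 3
                              (klSrcAction L'' M β U μ (klFlowFrameU L'' M β U μ (nScales β + 1)) (nScales β + 1))) 2 X -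
                            (if ∀ i j, ((X i).1.1.2 j).val / L = ((X 0).1.1.2 j).val / L then
                              kernel ℂ (srcTrunc ℂ (fun Y : SrcLabel L M (nScales β + 1) => Y.2 = 1) 3
                                (klSrcAction L M β U μ (klFlowFrameU L M β U μ (nScales β + 1)) (nScales β + 1))) 2
                                (fun i => ((((X i).1.1.1, fun j => ((((X i).1.1.2 j).val : ℕ) : ZMod L)), (X i).1.2), (X i).2))
                            else 0)‖) ≤ δ L ∧
                    klSrcPinnedSum L'' M β U μ (klFlowFrameU L'' M β U μ (nScales β + 1)) (nScales β + 1) 2 2 0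
                      ((of, ((⟨0, sectorCount_pos _⟩, 0), 0)), 1) ≤ B ∧
                    klSrcPinnedSum L M β U μ (klFlowFrameU L M β U μ (nScales β + 1)) (nScales β + 1) 2 2 0
                      (((of.1, fun i => (((of.2 i).val : ℕ) : ZMod L)), ((⟨0, sectorCount_pos _⟩, 0), 0)), 1) ≤ B) :
    ∀ (G : GeoConsts) (P : SplitConsts) (Q : EngConsts) (R : RenConsts), G.WF → P.WF → Q.WF → R.WF →
      ∃ c₅ : ℝ, 0 < c₅ ∧ ∀ c : ℝ, 0 < c → c ≤ c₅ → ∃ U₀ : ℝ, 0 < U₀ ∧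
        ∀ μ ∈ klWindowC, ∀ U : ℝ, 0 < U → U ≤ U₀ → ∀ β : ℝ, klBetaMin ≤ β → β ≤ Real.exp (c / U ^ 2) →
          ∀ K : TrigPolyC4v, klPredsV17F2.frameOK R U (nScales β) μ K →
            ∀ (Lstar : ℕ) (Mstar : ℕ → ℕ), TowerP klPredsV17F2 G P Q R β U μ K Lstar Mstar →
              ∀ n : ℤ, ∃ L₀ : ℕ, ∃ ρ : ℕ → ℝ, Tendsto ρ atTop (𝓝 0) ∧
                ∀ (L : ℕ) [NeZero L], L₀ ≤ L → ∀ (L'' : ℕ) [NeZero L''], L ∣ L'' → ∃ M₀ : ℕ, ∀ (M : ℕ) [NeZero M], M₀ ≤ M →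
                  ∀ (ω : MatsubaraIdx M), matsubaraInt M ω = n → ∀ (k : TorusSite 2 L) (k'' : TorusSite 2 L''),
                    latticeMomentum L'' k'' = latticeMomentum L k →
                      ‖klSelfEnergy L M β U μ (klFlowFrameU L M β U μ (nScales β + 1)) klE0 (nScales β + 1) (ω, k) 0 -
                          klSelfEnergy L'' M β U μ (klFlowFrameU L'' M β U μ (nScales β + 1)) klE0 (nScales β + 1) (ω, k'') 0‖ ≤ ρ L := by
  refine framedNestedFlowTextV17F2_of_srcActionNearDefect_srcPinnedSum fun G P Q R hG hP hQ hR => ?_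
  obtain ⟨c₅, hc₅, hc⟩ := hD G P Q R hG hP hQ hR
  refine ⟨c₅, hc₅, fun c hc0 hcc => ?_⟩
  obtain ⟨U₀, hU₀, hU⟩ := hc c hc0 hcc
  refine ⟨U₀, hU₀, fun μ hμ U hU0 hUU β hβmin hβmax K hK Lstar Mstar hT => ?_⟩
  have hβ : 0 < β := pos_of_klBetaMin_le hβmin
  have hΛ : 0 < klScale klE0 (nScales β + 1) := klth_klScale_pos _
  obtain ⟨L₀, δ, B, hδ, Rd, hRd, hDn⟩ := hU μ hμ U hU0 hUU β hβmin hβmax K hK Lstar Mstar hT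
  refine ⟨L₀, fun L => δ L + 2 * (B + B) / (1 + klScale klE0 (nScales β + 1) * (Rd L : ℝ)), B, ?_, fun L _ hL L'' _ b hb => ?_⟩
  · simpa using hδ.add (tendsto_farRate_of_depth hΛ (B + B) hRd)
  obtain ⟨M₀, hM₀⟩ := hDn L hL L'' b hb
  refine ⟨M₀, fun M _ hM => ?_⟩
  obtain ⟨of, hof, hglued, hBf, hBc⟩ := hM₀ M hM
  refine ⟨(of.1, fun i => (((of.2 i).val : ℕ) : ZMod L)), of, rfl, ?_, hBf⟩
  have h := twoEps_near_le_glued_add_far hb hβ.le U μ (klFlowFrameU L M β U μ (nScales β + 1)) (klFlowFrameU L'' M β U μ (nScales β + 1))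
    (nScales β + 1) of hof hBc hBf
  exact h.trans (add_le_add hglued le_rfl)

/-- **THE v9 STUB `stub_vl_nestedFramed` FROM THE GLUED PINNED DEFECT AT A DEEP FINE PIN** — the (vi) chain's own currency (M4a's conclusion shape at
degree `2`, pin = the `(+)` source leg, own top flow frames; token #24 for BOTH volumes is read from the stub's own hypothesis).  The conclusion is the
registered type of `…KLRegimeVolumeLimitV17F2.stub_vl_nestedFramed` in skeleton «cauchy» v9 (831d58cbda4d66f6). [cite: BenfattoGiulianiMastropietro2006, §2.9 (4.3)-(4.6)] -/
theorem stub_vl_nestedFramed_of_gluedDefect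
    (hGlued : ∀ (G : GeoConsts) (P : SplitConsts) (Q : EngConsts) (R : RenConsts), G.WF → P.WF → Q.WF → R.WF →
      ∃ c₅ : ℝ, 0 < c₅ ∧ ∀ c : ℝ, 0 < c → c ≤ c₅ → ∃ U₀ : ℝ, 0 < U₀ ∧
        ∀ μ ∈ klWindowC, ∀ U : ℝ, 0 < U → U ≤ U₀ → ∀ β : ℝ, klBetaMin ≤ β → β ≤ Real.exp (c / U ^ 2) →
          ∀ K : TrigPolyC4v, klPredsV17F2.frameOK R U (nScales β) μ K →
            ∀ (Lstar : ℕ) (Mstar : ℕ → ℕ), TowerP klPredsV17F2 G P Q R β U μ K Lstar Mstar →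
              ∃ L₀ : ℕ, ∃ δ : ℕ → ℝ, Tendsto δ atTop (𝓝 0) ∧ ∃ Rd : ℕ → ℕ, Tendsto Rd atTop atTop ∧
                ∀ (L : ℕ) [NeZero L], L₀ ≤ L → ∀ (L'' : ℕ) [NeZero L''] (b : ℕ), L'' = b * L → ∃ M₀ : ℕ, ∀ (M : ℕ) [NeZero M], M₀ ≤ M →
                  ∃ of : SpaceTimeIdx L'' M, (∀ j, Rd L ≤ (of.2 j).val % L ∧ (of.2 j).val % L + Rd L < L) ∧
                    2 * imagTimeWeight β M *
                      (∑ X ∈ univ.filter (fun X : Fin 2 → SrcLabel L'' M (nScales β + 1) => X 0 = ((of, ((⟨0, sectorCount_pos _⟩, 0), 0)), 1)),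
                        ‖kernel ℂ (srcTrunc ℂ (fun Y : SrcLabel L'' M (nScales β + 1) => Y.2 = 1) 3
                              (klSrcAction L'' M β U μ (klFlowFrameU L'' M β U μ (nScales β + 1)) (nScales β + 1))) 2 X -
                            (if ∀ i j, ((X i).1.1.2 j).val / L = ((X 0).1.1.2 j).val / L then
                              kernel ℂ (srcTrunc ℂ (fun Y : SrcLabel L M (nScales β + 1) => Y.2 = 1) 3
                                (klSrcAction L M β U μ (klFlowFrameU L M β U μ (nScales β + 1)) (nScales β + 1))) 2
                                (fun i => ((((X i).1.1.1, fun j => ((((X i).1.1.2 j).val : ℕ) : ZMod L)), (X i).1.2), (X i).2))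
                            else 0)‖) ≤ δ L) :
    (∀ (P : SplitConsts) (R : RenConsts), P.WF → R.WF2 →
      ∃ Q' : EngConsts, 0 ≤ Q'.CE ∧ ∃ c₀ : ℝ, 0 < c₀ ∧ ∀ c : ℝ, 0 < c → c ≤ c₀ → ∃ U₀ : ℝ, 0 < U₀ ∧
        ∀ μ ∈ klWindowC, ∀ U : ℝ, 0 < U → U ≤ U₀ → ∀ β : ℝ, klBetaMin ≤ β → β ≤ Real.exp (c / U ^ 2) →
          ∃ A : ℕ → ℕ → ℝ, ∃ L₁ : ℕ, ∃ M₁ : ℕ → ℕ, ∀ (L M : ℕ) [NeZero L] [NeZero M], L₁ ≤ L → M₁ L ≤ M →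
            ∀ j : ℕ, j ≤ nScales β + 1 →
              SourceProfilesAt L M (klSrcBudget P Q' U A j) β U μ (klFlowFrameU L M β U μ (nScales β + 1)) j) →
    ∀ (G : GeoConsts) (P : SplitConsts) (Q : EngConsts) (R : RenConsts), G.WF → P.WF → Q.WF → R.WF →
      ∃ c₅ : ℝ, 0 < c₅ ∧ ∀ c : ℝ, 0 < c → c ≤ c₅ → ∃ U₀ : ℝ, 0 < U₀ ∧
        ∀ μ ∈ klWindowC, ∀ U : ℝ, 0 < U → U ≤ U₀ → ∀ β : ℝ, klBetaMin ≤ β → β ≤ Real.exp (c / U ^ 2) →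
          ∀ K : TrigPolyC4v, klPredsV17F2.frameOK R U (nScales β) μ K →
            ∀ (Lstar : ℕ) (Mstar : ℕ → ℕ), TowerP klPredsV17F2 G P Q R β U μ K Lstar Mstar →
              ∀ n : ℤ, ∃ L₀ : ℕ, ∃ ρ : ℕ → ℝ, Tendsto ρ atTop (𝓝 0) ∧
                ∀ (L : ℕ) [NeZero L], L₀ ≤ L → ∀ (L'' : ℕ) [NeZero L''], L ∣ L'' → ∃ M₀ : ℕ, ∀ (M : ℕ) [NeZero M], M₀ ≤ M →
                  ∀ (ω : MatsubaraIdx M), matsubaraInt M ω = n → ∀ (k : TorusSite 2 L) (k'' : TorusSite 2 L''),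
                    latticeMomentum L'' k'' = latticeMomentum L k →
                      ‖klSelfEnergy L M β U μ (klFlowFrameU L M β U μ (nScales β + 1)) klE0 (nScales β + 1) (ω, k) 0 -
                          klSelfEnergy L'' M β U μ (klFlowFrameU L'' M β U μ (nScales β + 1)) klE0 (nScales β + 1) (ω, k'') 0‖ ≤ ρ L := by
  intro hSrc G P Q R hG hP hQ hR
  -- token #24 at `(P, R₁)`, `R₁ = ⟨1, 1, 1⟩` well-formed; thresholds shared by `min` / `max`
  have hR₁ : (⟨1, 1, fun _ => 1⟩ : RenConsts).WF2 := ⟨⟨zero_le_one, zero_le_one, fun _ => zero_le_one⟩, one_pos, one_pos⟩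
  refine framedNestedFlowTextV17F2_of_srcActionGluedDefect_srcPinnedSums ?_ G P Q R hG hP hQ hR
  intro G P Q R hG hP hQ hR
  obtain ⟨Q'', -, c₀', hc₀', hS'⟩ := hSrc P ⟨1, 1, fun _ => 1⟩ hP hR₁
  obtain ⟨c₅, hc₅, hN⟩ := hGlued G P Q R hG hP hQ hR
  refine ⟨min c₅ c₀', lt_min hc₅ hc₀', fun c hc0 hcc => ?_⟩
  obtain ⟨U₁, hU₁, hN1⟩ := hN c hc0 (hcc.trans (min_le_left _ _))
  obtain ⟨U₂, hU₂, hS2⟩ := hS' c hc0 (hcc.trans (min_le_right _ _))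
  refine ⟨min U₁ U₂, lt_min hU₁ hU₂, fun μ hμ U hU0 hUU β hβmin hβmax K hK Lstar Mstar hT => ?_⟩
  obtain ⟨L₀, δ, hδ, Rd, hRd, hLn⟩ := hN1 μ hμ U hU0 (hUU.trans (min_le_left _ _)) β hβmin hβmax K hK Lstar Mstar hT
  obtain ⟨A, L₁, M₁, hA⟩ := hS2 μ hμ U hU0 (hUU.trans (min_le_right _ _)) β hβmin hβmax
  refine ⟨max L₀ L₁, δ, A (nScales β + 1) 2, hδ, Rd, hRd, fun L _ hL L'' _ b hb => ?_⟩
  obtain ⟨M₀, hM₀⟩ := hLn L ((le_max_left _ _).trans hL) L'' b hb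
  have hLL'' : L ≤ L'' := Nat.le_of_dvd (Nat.pos_of_ne_zero (NeZero.ne L'')) ⟨b, by rw [hb, mul_comm]⟩
  have hL₁ : L₁ ≤ L := (le_max_right _ _).trans hL
  have hL₁'' : L₁ ≤ L'' := hL₁.trans hLL''
  refine ⟨max M₀ (max (M₁ L) (M₁ L'')), fun M _ hM => ?_⟩
  obtain ⟨of, hof, hglued⟩ := hM₀ M ((le_max_left _ _).trans hM)
  exact ⟨of, hof, hglued,
    klSrcPinnedSum_two_two_le_of_sourceProfilesAt
      (hA L'' M hL₁'' ((le_max_right _ _).trans ((le_max_right _ _).trans hM)) (nScales β + 1) le_rfl) 0 _,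
    klSrcPinnedSum_two_two_le_of_sourceProfilesAt
      (hA L M hL₁ ((le_max_left _ _).trans ((le_max_right _ _).trans hM)) (nScales β + 1) le_rfl) 0 _⟩

/-- **THE v9 STUB FROM THE GLUED DEFECT AT EVERY DEEP PIN** (∀-pin form, the literal shape of M4a's conclusion: the bound is supplied at every
`(R L)`-deep fine pin, with `2·R L < L` so that deep pins exist — `exists_deepSite` picks one). [cite: BenfattoGiulianiMastropietro2006, §2.9 (4.3)-(4.6)] -/
theorem stub_vl_nestedFramed_of_gluedDefect_forall
    (hGlued : ∀ (G : GeoConsts) (P : SplitConsts) (Q : EngConsts) (R : RenConsts), G.WF → P.WF → Q.WF → R.WF →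
      ∃ c₅ : ℝ, 0 < c₅ ∧ ∀ c : ℝ, 0 < c → c ≤ c₅ → ∃ U₀ : ℝ, 0 < U₀ ∧
        ∀ μ ∈ klWindowC, ∀ U : ℝ, 0 < U → U ≤ U₀ → ∀ β : ℝ, klBetaMin ≤ β → β ≤ Real.exp (c / U ^ 2) →
          ∀ K : TrigPolyC4v, klPredsV17F2.frameOK R U (nScales β) μ K →
            ∀ (Lstar : ℕ) (Mstar : ℕ → ℕ), TowerP klPredsV17F2 G P Q R β U μ K Lstar Mstar →
              ∃ L₀ : ℕ, ∃ δ : ℕ → ℝ, Tendsto δ atTop (𝓝 0) ∧ ∃ Rd : ℕ → ℕ, Tendsto Rd atTop atTop ∧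
                ∀ (L : ℕ) [NeZero L], L₀ ≤ L → 2 * Rd L < L ∧ ∀ (L'' : ℕ) [NeZero L''] (b : ℕ), L'' = b * L → ∃ M₀ : ℕ, ∀ (M : ℕ) [NeZero M], M₀ ≤ M →
                  ∀ of : SpaceTimeIdx L'' M, (∀ j, Rd L ≤ (of.2 j).val % L ∧ (of.2 j).val % L + Rd L < L) →
                    2 * imagTimeWeight β M *
                      (∑ X ∈ univ.filter (fun X : Fin 2 → SrcLabel L'' M (nScales β + 1) => X 0 = ((of, ((⟨0, sectorCount_pos _⟩, 0), 0)), 1)),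
                        ‖kernel ℂ (srcTrunc ℂ (fun Y : SrcLabel L'' M (nScales β + 1) => Y.2 = 1) 3
                              (klSrcAction L'' M β U μ (klFlowFrameU L'' M β U μ (nScales β + 1)) (nScales β + 1))) 2 X -
                            (if ∀ i j, ((X i).1.1.2 j).val / L = ((X 0).1.1.2 j).val / L then
                              kernel ℂ (srcTrunc ℂ (fun Y : SrcLabel L M (nScales β + 1) => Y.2 = 1) 3
                                (klSrcAction L M β U μ (klFlowFrameU L M β U μ (nScales β + 1)) (nScales β + 1))) 2
                                (fun i => ((((X i).1.1.1, fun j => ((((X i).1.1.2 j).val : ℕ) : ZMod L)), (X i).1.2), (X i).2))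
                            else 0)‖) ≤ δ L) :
    (∀ (P : SplitConsts) (R : RenConsts), P.WF → R.WF2 →
      ∃ Q' : EngConsts, 0 ≤ Q'.CE ∧ ∃ c₀ : ℝ, 0 < c₀ ∧ ∀ c : ℝ, 0 < c → c ≤ c₀ → ∃ U₀ : ℝ, 0 < U₀ ∧
        ∀ μ ∈ klWindowC, ∀ U : ℝ, 0 < U → U ≤ U₀ → ∀ β : ℝ, klBetaMin ≤ β → β ≤ Real.exp (c / U ^ 2) →
          ∃ A : ℕ → ℕ → ℝ, ∃ L₁ : ℕ, ∃ M₁ : ℕ → ℕ, ∀ (L M : ℕ) [NeZero L] [NeZero M], L₁ ≤ L → M₁ L ≤ M →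
            ∀ j : ℕ, j ≤ nScales β + 1 →
              SourceProfilesAt L M (klSrcBudget P Q' U A j) β U μ (klFlowFrameU L M β U μ (nScales β + 1)) j) →
    ∀ (G : GeoConsts) (P : SplitConsts) (Q : EngConsts) (R : RenConsts), G.WF → P.WF → Q.WF → R.WF →
      ∃ c₅ : ℝ, 0 < c₅ ∧ ∀ c : ℝ, 0 < c → c ≤ c₅ → ∃ U₀ : ℝ, 0 < U₀ ∧
        ∀ μ ∈ klWindowC, ∀ U : ℝ, 0 < U → U ≤ U₀ → ∀ β : ℝ, klBetaMin ≤ β → β ≤ Real.exp (c / U ^ 2) →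
          ∀ K : TrigPolyC4v, klPredsV17F2.frameOK R U (nScales β) μ K →
            ∀ (Lstar : ℕ) (Mstar : ℕ → ℕ), TowerP klPredsV17F2 G P Q R β U μ K Lstar Mstar →
              ∀ n : ℤ, ∃ L₀ : ℕ, ∃ ρ : ℕ → ℝ, Tendsto ρ atTop (𝓝 0) ∧
                ∀ (L : ℕ) [NeZero L], L₀ ≤ L → ∀ (L'' : ℕ) [NeZero L''], L ∣ L'' → ∃ M₀ : ℕ, ∀ (M : ℕ) [NeZero M], M₀ ≤ M →
                  ∀ (ω : MatsubaraIdx M), matsubaraInt M ω = n → ∀ (k : TorusSite 2 L) (k'' : TorusSite 2 L''),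
                    latticeMomentum L'' k'' = latticeMomentum L k →
                      ‖klSelfEnergy L M β U μ (klFlowFrameU L M β U μ (nScales β + 1)) klE0 (nScales β + 1) (ω, k) 0 -
                          klSelfEnergy L'' M β U μ (klFlowFrameU L'' M β U μ (nScales β + 1)) klE0 (nScales β + 1) (ω, k'') 0‖ ≤ ρ L := by
  refine stub_vl_nestedFramed_of_gluedDefect fun G P Q R hG hP hQ hR => ?_
  obtain ⟨c₅, hc₅, hc⟩ := hGlued G P Q R hG hP hQ hR
  refine ⟨c₅, hc₅, fun c hc0 hcc => ?_⟩
  obtain ⟨U₀, hU₀, hU⟩ := hc c hc0 hcc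
  refine ⟨U₀, hU₀, fun μ hμ U hU0 hUU β hβmin hβmax K hK Lstar Mstar hT => ?_⟩
  obtain ⟨L₀, δ, hδ, Rd, hRd, hDn⟩ := hU μ hμ U hU0 hUU β hβmin hβmax K hK Lstar Mstar hT
  refine ⟨L₀, δ, hδ, Rd, hRd, fun L _ hL L'' _ b hb => ?_⟩
  obtain ⟨h2R, hLn⟩ := hDn L hL
  obtain ⟨M₀, hM₀⟩ := hLn L'' b hb
  refine ⟨M₀, fun M _ hM => ?_⟩
  obtain ⟨x', hx'⟩ := exists_deepSite hb h2R
  have h2M : 0 < 2 * M := by have := NeZero.pos M; omega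
  exact ⟨((⟨0, h2M⟩ : ImagTimeIdx M), x'), hx', hM₀ M hM (⟨0, h2M⟩, x') hx'⟩

end Summit.HubbardSuperconductivity.HubbardSuperconductivity.Theorems.TwoPointAssembly

end

/-! ## §3 (addendum) The e-KEYED block-reduced form — M3a's literal conclusion shape (`…TwoVolumeSectorScaleSucc`), doubled block structure `ed`
over the sector-field block structure `e` (`…TwoVolumeDoubledData.exists_doubledEquiv`, `…TwoVolumeSectorPeriodisation.exists_sectorFieldBlockEquiv`) -/

noncomputable section

namespace Summit.HubbardSuperconductivity.HubbardSuperconductivity.Theorems.TwoVolumeDefect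

set_option linter.dupNamespace false -- summit = problem name (single-conjunct summit), D-0017

open Finset Literature.MathematicalPhysics.QuantumLattice GrassmannAlgebra Literature.Probability.LatticeModels

section Keyed

variable {b L Lf : ℕ} {T S C : Type*}
  (e : (T × TorusSite 2 Lf) × S ≃ (Fin 2 → Fin b) × ((T × TorusSite 2 L) × S))
  (ed : ((T × TorusSite 2 Lf) × S) × C ≃ (Fin 2 → Fin b) × (((T × TorusSite 2 L) × S) × C))

/-- The doubled block structure reads the block of the undoubled label. [folklore] -/
theorem doubledEquiv_fst (hed : ∀ x s, ed (x, s) = ((e x).1, ((e x).2, s))) (X' : ((T × TorusSite 2 Lf) × S) × C) :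
    (ed X').1 = (e X'.1).1 := by
  have h := hed X'.1 X'.2
  rw [Prod.mk.eta] at h
  rw [h]

/-- The doubled block structure projects to `(projection of the undoubled label, copy)`. [folklore] -/
theorem doubledEquiv_snd (hed : ∀ x s, ed (x, s) = ((e x).1, ((e x).2, s))) (X' : ((T × TorusSite 2 Lf) × S) × C) :
    (ed X').2 = ((e X'.1).2, X'.2) := by
  have h := hed X'.1 X'.2
  rw [Prod.mk.eta] at h
  rw [h]

/-- **The keyed block test IS the e-free block test**: all legs of `X` lie in the block of leg `p` (as read by `ed`) iff their site quotients by `L` agree.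
[folklore] -/
theorem blockTest_iff_of_doubledEquiv (he1 : ∀ X' i, ((e X').1 i : ℕ) = (X'.1.2 i).val / L) (hed : ∀ x s, ed (x, s) = ((e x).1, ((e x).2, s)))
    {m : ℕ} (p : Fin m) (X : Fin m → ((T × TorusSite 2 Lf) × S) × C) :
    (∀ i, (ed (X i)).1 = (ed (X p)).1) ↔ ∀ i j, ((X i).1.1.2 j).val / L = ((X p).1.1.2 j).val / L := by
  simp only [doubledEquiv_fst e ed hed]
  refine ⟨fun h i j => ?_, fun h i => funext fun j => Fin.ext ?_⟩
  · rw [← he1 (X i).1 j, ← he1 (X p).1 j, h i]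
  · rw [he1, he1]; exact h i j

/-- **The keyed residue string IS the e-free residue string.** [folklore] -/
theorem residueString_eq_of_doubledEquiv (he2 : ∀ X', (e X').2 = ((X'.1.1, fun i => (((X'.1.2 i).val : ℕ) : ZMod L)), X'.2))
    (hed : ∀ x s, ed (x, s) = ((e x).1, ((e x).2, s))) {m : ℕ} (X : Fin m → ((T × TorusSite 2 Lf) × S) × C) :
    (fun i => (ed (X i)).2) = fun i => ((((X i).1.1.1, fun j => ((((X i).1.1.2 j).val : ℕ) : ZMod L)), (X i).1.2), (X i).2) := by
  funext i
  rw [doubledEquiv_snd e ed hed, he2]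

/-- **KEYED = e-FREE for the block-reduced kernel**: M3a's conclusion summand in the doubled block structure equals the e-free summand of
`…VolumeLimitV9GluedDefectDoor` / `…TwoVolumeGluedSourcePair`. [folklore] -/
theorem keyedReduced_eq_ite [Fintype T] [DecidableEq T] [Fintype S] [DecidableEq S] [Fintype C] [DecidableEq C] [NeZero L]
    (he1 : ∀ X' i, ((e X').1 i : ℕ) = (X'.1.2 i).val / L) (he2 : ∀ X', (e X').2 = ((X'.1.1, fun i => (((X'.1.2 i).val : ℕ) : ZMod L)), X'.2))
    (hed : ∀ x s, ed (x, s) = ((e x).1, ((e x).2, s))) (A : GrassmannAlgebra ℂ (((T × TorusSite 2 L) × S) × C))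
    {m : ℕ} (p : Fin m) (X : Fin m → ((T × TorusSite 2 Lf) × S) × C) :
    (if ∀ i, (ed (X i)).1 = (ed (X p)).1 then kernel ℂ A m (fun i => (ed (X i)).2) else 0) =
      if ∀ i j, ((X i).1.1.2 j).val / L = ((X p).1.1.2 j).val / L then
        kernel ℂ A m (fun i => ((((X i).1.1.1, fun j => ((((X i).1.1.2 j).val : ℕ) : ZMod L)), (X i).1.2), (X i).2)) else 0 := by
  rw [residueString_eq_of_doubledEquiv e ed he2 hed]
  by_cases h : ∀ i j, ((X i).1.1.2 j).val / L = ((X p).1.1.2 j).val / L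
  · rw [if_pos ((blockTest_iff_of_doubledEquiv e ed he1 hed p X).2 h), if_pos h]
  · rw [if_neg (fun h' => h ((blockTest_iff_of_doubledEquiv e ed he1 hed p X).1 h')), if_neg h]

end Keyed

end Summit.HubbardSuperconductivity.HubbardSuperconductivity.Theorems.TwoVolumeDefect

namespace Summit.HubbardSuperconductivity.HubbardSuperconductivity.Theorems.TwoPointAssembly

set_option linter.dupNamespace false -- summit = problem name (single-conjunct summit), D-0017

open Finset Filter Topology Complex Literature.MathematicalPhysics.QuantumLattice Literature.Probability.LatticeModels GrassmannAlgebra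
open Summit.HubbardSuperconductivity.HubbardSuperconductivity.Theorems.KLRegimeSplit
open Summit.HubbardSuperconductivity.HubbardSuperconductivity.Theorems.KLProgrammeLegKernels
open Summit.HubbardSuperconductivity.HubbardSuperconductivity.Theorems.EngineV8
open Summit.HubbardSuperconductivity.HubbardSuperconductivity.Theorems.TwoVolumeDefect
open Summit.HubbardSuperconductivity.HubbardSuperconductivity.Theorems.TwoVolumeSource

/-- **THE v9 STUB FROM THE KEYED GLUED DEFECT** — M3a's literal conclusion shape at the last scale on the doubled labels: for SOME sector-field block
structure `e` (block `⌊x⃗/L⌋`, projection `((x₀,x⃗),ℓ) ↦ ((x₀, red x⃗), ℓ)`, `exists_sectorFieldBlockEquiv`) and its doubling `ed` (`exists_doubledEquiv`), an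
`(R L)`-deep fine pin `o_f` with `2ε·Σ_{X : X 0 = pin} ‖kernel A_{L″} 2 X − (if ∀ i, (ed (X i)).1 = (ed (X 0)).1 then kernel A_L 2 (ed ∘ X).2 else 0)‖ ≤ δ L`.
[cite: BenfattoGiulianiMastropietro2006, §2.9 (4.3)-(4.6)] -/
theorem stub_vl_nestedFramed_of_gluedDefect_keyed
    (hGlued : ∀ (G : GeoConsts) (P : SplitConsts) (Q : EngConsts) (R : RenConsts), G.WF → P.WF → Q.WF → R.WF →
      ∃ c₅ : ℝ, 0 < c₅ ∧ ∀ c : ℝ, 0 < c → c ≤ c₅ → ∃ U₀ : ℝ, 0 < U₀ ∧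
        ∀ μ ∈ klWindowC, ∀ U : ℝ, 0 < U → U ≤ U₀ → ∀ β : ℝ, klBetaMin ≤ β → β ≤ Real.exp (c / U ^ 2) →
          ∀ K : TrigPolyC4v, klPredsV17F2.frameOK R U (nScales β) μ K →
            ∀ (Lstar : ℕ) (Mstar : ℕ → ℕ), TowerP klPredsV17F2 G P Q R β U μ K Lstar Mstar →
              ∃ L₀ : ℕ, ∃ δ : ℕ → ℝ, Tendsto δ atTop (𝓝 0) ∧ ∃ Rd : ℕ → ℕ, Tendsto Rd atTop atTop ∧
                ∀ (L : ℕ) [NeZero L], L₀ ≤ L → ∀ (L'' : ℕ) [NeZero L''] (b : ℕ), L'' = b * L → ∃ M₀ : ℕ, ∀ (M : ℕ) [NeZero M], M₀ ≤ M →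
                  ∃ (e : (SpaceTimeIdx L'' M × SectorLeg (sectorCount (nScales β + 1))) ≃
                      (Fin 2 → Fin b) × (SpaceTimeIdx L M × SectorLeg (sectorCount (nScales β + 1))))
                    (ed : SrcLabel L'' M (nScales β + 1) ≃ (Fin 2 → Fin b) × SrcLabel L M (nScales β + 1)),
                    (∀ X' i, ((e X').1 i : ℕ) = (X'.1.2 i).val / L) ∧
                    (∀ X', (e X').2 = ((X'.1.1, fun i => (((X'.1.2 i).val : ℕ) : ZMod L)), X'.2)) ∧
                    (∀ x s, ed (x, s) = ((e x).1, ((e x).2, s))) ∧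
                  ∃ of : SpaceTimeIdx L'' M, (∀ j, Rd L ≤ (of.2 j).val % L ∧ (of.2 j).val % L + Rd L < L) ∧
                    2 * imagTimeWeight β M *
                      (∑ X ∈ univ.filter (fun X : Fin 2 → SrcLabel L'' M (nScales β + 1) => X 0 = ((of, ((⟨0, sectorCount_pos _⟩, 0), 0)), 1)),
                        ‖kernel ℂ (srcTrunc ℂ (fun Y : SrcLabel L'' M (nScales β + 1) => Y.2 = 1) 3
                              (klSrcAction L'' M β U μ (klFlowFrameU L'' M β U μ (nScales β + 1)) (nScales β + 1))) 2 X -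
                            (if ∀ i, (ed (X i)).1 = (ed (X 0)).1 then
                              kernel ℂ (srcTrunc ℂ (fun Y : SrcLabel L M (nScales β + 1) => Y.2 = 1) 3
                                (klSrcAction L M β U μ (klFlowFrameU L M β U μ (nScales β + 1)) (nScales β + 1))) 2
                                (fun i => (ed (X i)).2)
                            else 0)‖) ≤ δ L) :
    (∀ (P : SplitConsts) (R : RenConsts), P.WF → R.WF2 →
      ∃ Q' : EngConsts, 0 ≤ Q'.CE ∧ ∃ c₀ : ℝ, 0 < c₀ ∧ ∀ c : ℝ, 0 < c → c ≤ c₀ → ∃ U₀ : ℝ, 0 < U₀ ∧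
        ∀ μ ∈ klWindowC, ∀ U : ℝ, 0 < U → U ≤ U₀ → ∀ β : ℝ, klBetaMin ≤ β → β ≤ Real.exp (c / U ^ 2) →
          ∃ A : ℕ → ℕ → ℝ, ∃ L₁ : ℕ, ∃ M₁ : ℕ → ℕ, ∀ (L M : ℕ) [NeZero L] [NeZero M], L₁ ≤ L → M₁ L ≤ M →
            ∀ j : ℕ, j ≤ nScales β + 1 →
              SourceProfilesAt L M (klSrcBudget P Q' U A j) β U μ (klFlowFrameU L M β U μ (nScales β + 1)) j) →
    ∀ (G : GeoConsts) (P : SplitConsts) (Q : EngConsts) (R : RenConsts), G.WF → P.WF → Q.WF → R.WF →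
      ∃ c₅ : ℝ, 0 < c₅ ∧ ∀ c : ℝ, 0 < c → c ≤ c₅ → ∃ U₀ : ℝ, 0 < U₀ ∧
        ∀ μ ∈ klWindowC, ∀ U : ℝ, 0 < U → U ≤ U₀ → ∀ β : ℝ, klBetaMin ≤ β → β ≤ Real.exp (c / U ^ 2) →
          ∀ K : TrigPolyC4v, klPredsV17F2.frameOK R U (nScales β) μ K →
            ∀ (Lstar : ℕ) (Mstar : ℕ → ℕ), TowerP klPredsV17F2 G P Q R β U μ K Lstar Mstar →
              ∀ n : ℤ, ∃ L₀ : ℕ, ∃ ρ : ℕ → ℝ, Tendsto ρ atTop (𝓝 0) ∧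
                ∀ (L : ℕ) [NeZero L], L₀ ≤ L → ∀ (L'' : ℕ) [NeZero L''], L ∣ L'' → ∃ M₀ : ℕ, ∀ (M : ℕ) [NeZero M], M₀ ≤ M →
                  ∀ (ω : MatsubaraIdx M), matsubaraInt M ω = n → ∀ (k : TorusSite 2 L) (k'' : TorusSite 2 L''),
                    latticeMomentum L'' k'' = latticeMomentum L k →
                      ‖klSelfEnergy L M β U μ (klFlowFrameU L M β U μ (nScales β + 1)) klE0 (nScales β + 1) (ω, k) 0 -
                          klSelfEnergy L'' M β U μ (klFlowFrameU L'' M β U μ (nScales β + 1)) klE0 (nScales β + 1) (ω, k'') 0‖ ≤ ρ L := by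
  refine stub_vl_nestedFramed_of_gluedDefect fun G P Q R hG hP hQ hR => ?_
  obtain ⟨c₅, hc₅, hc⟩ := hGlued G P Q R hG hP hQ hR
  refine ⟨c₅, hc₅, fun c hc0 hcc => ?_⟩
  obtain ⟨U₀, hU₀, hU⟩ := hc c hc0 hcc
  refine ⟨U₀, hU₀, fun μ hμ U hU0 hUU β hβmin hβmax K hK Lstar Mstar hT => ?_⟩
  obtain ⟨L₀, δ, hδ, Rd, hRd, hDn⟩ := hU μ hμ U hU0 hUU β hβmin hβmax K hK Lstar Mstar hT
  refine ⟨L₀, δ, hδ, Rd, hRd, fun L _ hL L'' _ b hb => ?_⟩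
  obtain ⟨M₀, hM₀⟩ := hDn L hL L'' b hb
  refine ⟨M₀, fun M _ hM => ?_⟩
  obtain ⟨e, ed, he1, he2, hed, of, hof, hglued⟩ := hM₀ M hM
  refine ⟨of, hof, ?_⟩
  refine le_trans (le_of_eq ?_) hglued
  congr 1
  refine sum_congr rfl fun X _ => ?_
  rw [keyedReduced_eq_ite e ed he1 he2 hed]

end Summit.HubbardSuperconductivity.HubbardSuperconductivity.Theorems.TwoPointAssembly

end
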